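import Mathlib
import HarnessLib
import Literature.Computability.AlgebraicComplexity.ArithCircuit
import Literature.Computability.AlgebraicComplexity.CircuitDepth
import Literature.Computability.AlgebraicComplexity.ArithCircuitProofs
import Literature.Computability.AlgebraicComplexity.ArithCircuitProjections
import Literature.Computability.AlgebraicComplexity.StandardFamilies
import Literature.Computability.AlgebraicComplexity.ZModCircuitIntegerCodes
import Literature.Computability.AlgebraicComplexity.ValiantBooleanBridge
import Literature.Computability.Complexity.Circuit
import Literature.Computability.Complexity.CircuitComposition
import Literature.Computability.Complexity.BoolEncodings
import Literature.Computability.Complexity.TM2PassThrough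
import Literature.Computability.AlgebraicComplexity.BurgisserBooleanPartsA3Steps
import Literature.Computability.MetaComplexity.MCSPProofs
import Summits.ValiantsHypothesis.ValiantsHypothesis.Theorems.SuccinctLiftIntegerAdvice
import Summits.ValiantsHypothesis.ValiantsHypothesis.Theorems.SuccinctLiftGenericSkeletons
import Summits.ValiantsHypothesis.ValiantsHypothesis.Theorems.MonotoneRestorationOrbitRestorationQPVsbr

/-!
# Succinct lift — w9a: code words of constant-free circuits and their table circuits

Route `route-ValiantsHypothesis-SuccinctLift` (lens 2: natural-proofs / succinctness axis), generation 7, first of two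
files (the second, `SuccinctLiftDescriptionDial.lean`, decides the top of the description dial with these bricks).

The route's crux `A = SuccinctPerHardLog3` forbids, for PER at product-depth `Δ₁(n) = ⌊log₂ log₂ log₂ n⌋ + 1` and
`n^c + c` wires, constant-free integer circuits whose Boolean CODE WORD `encodeArithCircuit (n²) C` is computed, bit by
bit from the address, by a `B₂`-circuit with at most `n + c` gates.  Here:

* `exists_tableCircuit` — every bit string is read off a `w`-bit address by a `B₂`-circuit with at most `5 · 2^w`
  gates (Shannon expansion, the tree's `cktSize_univ`);
* `length_encodeArithCircuit_le` / `_le_sq` — the code word of a well-formed constant-free circuit with `N` inputs,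
  `s` gates and `e ≥ s` wires has length `≤ 8 (N + e + 27)²`;
* `hasSignConstants_pruneEmpty`, `exists_normalForm_signConst` — every constant-free circuit has a well-formed
  constant-free normal form with the same value, no larger product-depth, no more wires, and at most as many gates as
  wires;
* `PerEasySuccinctCF β Δ` — the succinctness budget of `A` as a PARAMETER `β n c` (the description dial), with
  `perEasyCF_of_succinct` (forgetting the description) and `perEasySuccinctCF_mono` (monotone in the budget).

References: Jansen–Santhanam 2011 (`JansenSanthanam2011`: succinct circuits = small circuits for the description),
Chen–Kabanets 2012 (`ChenKabanets2012`, Def. 2.1: `α`-succinct / `α`-weakly uniform), Arora–Barak 2009 Claim 2.13,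
Bürgisser 2000 §1.4 / Malod 2003 (constant-free circuits have finite codes), Kabanets–Impagliazzo 2004 §2.
-/

namespace Summit.ValiantsHypothesis.ValiantsHypothesis.Theorems.SuccinctLift

open Literature.Computability.AlgebraicComplexity Literature.Computability.Complexity Computability
open ArithCircuit

/-! ### 1. Table circuits: every bit string is `5 · 2^w`-succinct -/

section TableCircuits

/- `univBound m + 4 ≤ 5 · 2^m` is the tree's `MetaComplexity.MCSPVerif.univBound_le`; sign constants have
`|c| ≤ 1` by the tree's `AlgebraicComplexity.natAbs_le_one_of_isSignConstant` (both re-used by name). -/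

/-- **Table circuits.** Every bit string `l` is read off a `w`-bit (little-endian) address by a
`B₂`-circuit with at most `5 · 2^w` gates (Shannon expansion; no hypothesis on `l.length`, out-of-range
addresses return `false`). [cite: AroraBarakCC2009, Claim 2.13] -/
theorem exists_tableCircuit (w : ℕ) (l : List Bool) :
    ∃ D : Literature.Computability.Complexity.Circuit (Fin w),
      D.IsOver Literature.Computability.Complexity.B2 ∧ D.size ≤ 5 * 2 ^ w ∧
        D.Computes fun a => l.getD (∑ t : Fin w, if a t then 2 ^ (t : ℕ) else 0) false := by
  obtain ⟨D, hO, hs, hev⟩ := (cktSize_univ (ι := Fin w)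
    (fun (a : Fin w → Bool) (_ : Unit) =>
      l.getD (∑ t : Fin w, if a t then 2 ^ (t : ℕ) else 0) false)).toCircuit
  refine ⟨D, hO, ?_, fun a => hev a⟩
  rw [Fintype.card_fin] at hs
  have := Literature.Computability.MetaComplexity.MCSPVerif.univBound_le w
  omega

end TableCircuits

/-! ### 2. Code length of constant-free circuits -/

section CodeLength

/-- `|unary n| = n`. [folklore] -/
private theorem length_unaryEncodeNat (n : ℕ) : (unaryEncodeNat n).length = n :=
  unary_decode_encode_nat n

/-- Exact length of a `listBool` code. [cite: AroraBarak2009, §0.1] -/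
private theorem length_listBool_encode {α : Type} (e : Encoding α Bool) (l : List α) :
    (e.listBool.encode l).length =
      2 * l.length + 2 + (l.map fun a => 2 * (e.encode a).length + 2).sum := by
  change (boolPair (unaryEncodeNat l.length)
    (l.foldr (fun a acc => boolPair (e.encode a) acc) [])).length = _
  rw [length_boolPair, length_unaryEncodeNat]
  congr 1
  induction l with
  | nil => rfl
  | cons a l ih =>
    simp only [List.foldr_cons, length_boolPair, List.map_cons, List.sum_cons]
    rw [ih]

/-- `|code of z| ≤ |z| + 5` for the sign/binary integer code. [cite: AroraBarak2009, §0.1] -/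
theorem length_encodingIntBool_le (z : ℤ) : (encodingIntBool.encode z).length ≤ z.natAbs + 5 := by
  change (boolPair (encodeBool (decide (z < 0))) (encodeNat z.natAbs)).length ≤ _
  rw [length_boolPair]
  have h1 : (encodeBool (decide (z < 0))).length = 1 := rfl
  have h2 := TM2Pass.length_encodeNat_le_self z.natAbs
  omega

/-- `RefsBelow` is monotone in the bound. [cite: Burgisser2000, Def. 2.1] -/
theorem Operand.refsBelow_mono {k : Type*} {σ : Type*} {i m : ℕ} (him : i ≤ m) {u : Operand k σ}
    (h : u.RefsBelow i) : u.RefsBelow m := by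
  cases u with
  | var x => trivial
  | const c => trivial
  | gate j => exact lt_of_lt_of_le h him

/-- Length of an operand code: variables `< N`, gate references `< m`, sign constants.
[cite: KabanetsImpagliazzo2004, §2: circuits as strings] -/
theorem length_operandEncoding_le {N m : ℕ} (u : Operand ℤ (Fin N))
    (hs : u.HasSignConstants) (hr : u.RefsBelow m) :
    ((operandEncoding N).encode u).length ≤ N + m + 8 := by
  cases u with
  | var i =>
    change (false :: false :: encodeNat i.val).length ≤ _
    have h := TM2Pass.length_encodeNat_le_self i.val
    have hi := i.isLt
    simp only [List.length_cons]
    omega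
  | const c =>
    change (false :: true :: encodingIntBool.encode c).length ≤ _
    have h := length_encodingIntBool_le c
    have hc : c.natAbs ≤ 1 := natAbs_le_one_of_isSignConstant hs
    simp only [List.length_cons]
    omega
  | gate j =>
    change (true :: encodeNat j).length ≤ _
    have h := TM2Pass.length_encodeNat_le_self j
    have hj : j < m := hr
    simp only [List.length_cons]
    omega

/-- Length of a gate code in terms of its fan-in. [cite: KabanetsImpagliazzo2004, §2] -/
theorem length_gateEncoding_le {N m : ℕ} (g : Gate ℤ (Fin N))
    (hs : g.HasSignConstants) (hr : ∀ u ∈ g.args, u.RefsBelow m) :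
    ((gateEncoding N).encode g).length ≤ g.fanIn * (2 * (N + m) + 48) + 3 := by
  cases g with
  | sum args =>
    change (false ::
      (encodingIntBool.pairBool (operandEncoding N)).listBool.encode args).length ≤ _
    rw [List.length_cons, length_listBool_encode]
    have hf : (Gate.sum args : Gate ℤ (Fin N)).fanIn = args.length := by
      simp [ArithCircuit.Gate.fanIn, ArithCircuit.Gate.args]
    have hitem : ∀ x ∈ args.map (fun a =>
        2 * ((encodingIntBool.pairBool (operandEncoding N)).encode a).length + 2),
        x ≤ 2 * (N + m) + 46 := by
      intro x hx
      obtain ⟨a, ha, rfl⟩ := List.mem_map.1 hx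
      change 2 * (boolPair (encodingIntBool.encode a.1)
        ((operandEncoding N).encode a.2)).length + 2 ≤ _
      rw [length_boolPair]
      obtain ⟨h1, h2⟩ := hs a ha
      have hl1 := length_encodingIntBool_le a.1
      have hc := natAbs_le_one_of_isSignConstant h1
      have hl2 := length_operandEncoding_le a.2 h2
        (hr a.2 (by simp only [ArithCircuit.Gate.args, List.mem_map]; exact ⟨a, ha, rfl⟩))
      omega
    have hsum := List.sum_le_card_nsmul _ _ hitem
    rw [List.length_map, smul_eq_mul] at hsum
    rw [hf]
    nlinarith [hsum, args.length.zero_le]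
  | prod args =>
    change (true :: (operandEncoding N).listBool.encode args).length ≤ _
    rw [List.length_cons, length_listBool_encode]
    have hf : (Gate.prod args : Gate ℤ (Fin N)).fanIn = args.length := by
      simp [ArithCircuit.Gate.fanIn, ArithCircuit.Gate.args]
    have hitem : ∀ x ∈ args.map (fun a => 2 * ((operandEncoding N).encode a).length + 2),
        x ≤ 2 * (N + m) + 18 := by
      intro x hx
      obtain ⟨a, ha, rfl⟩ := List.mem_map.1 hx
      have hl2 := length_operandEncoding_le a (hs a ha) (hr a (by simpa [ArithCircuit.Gate.args] using ha))
      omega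
    have hsum := List.sum_le_card_nsmul _ _ hitem
    rw [List.length_map, smul_eq_mul] at hsum
    rw [hf]
    nlinarith [hsum, args.length.zero_le]

/-- **Code length of a constant-free circuit**: linear in `(N + s) · e`, where `N` is the number of
inputs, `s` the number of gates and `e` the number of wires. [cite: Burgisser2000, §1.4] -/
theorem length_encodeArithCircuit_le {N : ℕ} (C : ArithCircuit ℤ (Fin N))
    (hwf : C.WellFormed) (hs : C.HasSignConstants) :
    (encodeArithCircuit N C).length ≤
      (8 * (N + C.size) + 192) * C.edgeSize + 21 * C.size + N + 14 := by
  change (boolPair ((gateEncoding N).listBool.encode C.gates)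
    ((operandEncoding N).encode C.output)).length ≤ _
  rw [length_boolPair, length_listBool_encode]
  have hout := length_operandEncoding_le C.output hs.2 hwf.2
  have hgates : (C.gates.map fun g => 2 * ((gateEncoding N).encode g).length + 2).sum ≤
      (C.gates.map fun g => g.fanIn * (2 * (2 * (N + C.size) + 48)) + 8).sum := by
    apply List.sum_le_sum
    intro g hg
    obtain ⟨i, hi, hgi⟩ := List.mem_iff_getElem.1 hg
    have hi' : i ≤ C.size := le_of_lt hi
    have hget : C.gates[i]? = some g := by rw [List.getElem?_eq_getElem hi, hgi]
    have hrefs : ∀ u ∈ g.args, u.RefsBelow C.size := fun u hu =>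
      Operand.refsBelow_mono hi' (hwf.1 i g hget u hu)
    have := length_gateEncoding_le g (hs.1 g hg) hrefs
    nlinarith [this, g.fanIn.zero_le]
  have hsplit : (C.gates.map fun g => g.fanIn * (2 * (2 * (N + C.size) + 48)) + 8).sum =
      C.edgeSize * (2 * (2 * (N + C.size) + 48)) + C.size * 8 := by
    rw [List.sum_map_add, List.sum_map_mul_right]
    simp only [List.map_const', List.sum_replicate, smul_eq_mul]
    rfl
  have hsz : C.gates.length = C.size := rfl
  rw [hsz]
  nlinarith [hgates, hsplit, hout, C.edgeSize.zero_le, C.size.zero_le]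

/-- Clean quadratic form when the circuit has at most as many gates as wires.
[cite: Burgisser2000, §1.4] -/
theorem length_encodeArithCircuit_le_sq {N : ℕ} (C : ArithCircuit ℤ (Fin N))
    (hwf : C.WellFormed) (hs : C.HasSignConstants) (hse : C.size ≤ C.edgeSize) :
    (encodeArithCircuit N C).length ≤ 8 * (N + C.edgeSize + 27) ^ 2 := by
  have h := length_encodeArithCircuit_le C hwf hs
  nlinarith [h, hse, C.edgeSize.zero_le, (N).zero_le, Nat.mul_le_mul_right C.edgeSize hse]

end CodeLength

/-! ### 3. A constant-free normal form -/

section NormalForm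

open ArithCircuit.EmptyGatePruning

variable {k : Type*} [CommSemiring k] {σ : Type*}

/-- The constant replacing an empty gate is `0` or `1`. [cite: Burgisser2000, §1.4] -/
theorem isSignConstant_cval (G : List (Gate k σ)) (j : ℕ) : IsSignConstant (cval G j) := by
  unfold cval
  split <;> simp [IsSignConstant]

/-- Operand rewriting keeps sign constants. [cite: Burgisser2000, §1.4] -/
theorem Operand.hasSignConstants_rwOp (G : List (Gate k σ)) (i : ℕ) {u : Operand k σ}
    (h : u.HasSignConstants) : (rwOp G i u).HasSignConstants := by
  cases u with
  | var x => trivial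
  | const c => exact h
  | gate j =>
    simp only [rwOp]
    split
    · split
      · trivial
      · exact isSignConstant_cval G j
    · exact Or.inl rfl

/-- `Gate.mapOps` along a sign-constant-preserving map keeps sign constants. [cite: Burgisser2000, §1.4] -/
theorem Gate.hasSignConstants_mapOps {f : Operand k σ → Operand k σ}
    (hf : ∀ u : Operand k σ, u.HasSignConstants → (f u).HasSignConstants) {g : Gate k σ}
    (h : g.HasSignConstants) : (g.mapOps f).HasSignConstants := by
  cases g with
  | sum args =>
    intro a ha
    simp only [List.mem_map] at ha
    obtain ⟨b, hb, rfl⟩ := ha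
    exact ⟨(h b hb).1, hf _ (h b hb).2⟩
  | prod args =>
    intro u hu
    simp only [List.mem_map] at hu
    obtain ⟨v, hv, rfl⟩ := hu
    exact hf _ (h v hv)

/-- **Empty-gate pruning keeps the constant-free property** (new constants are `0`, `1`).
[cite: Burgisser2000, §1.4] -/
theorem hasSignConstants_pruneEmpty {P : ArithCircuit k σ} (h : P.HasSignConstants) :
    P.pruneEmpty.HasSignConstants := by
  refine ⟨fun g hg => ?_, Operand.hasSignConstants_rwOp _ _ h.2⟩
  simp only [pruneEmpty, newGates, List.mem_filter, List.mem_mapIdx] at hg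
  obtain ⟨⟨i, hi, rfl⟩, -⟩ := hg
  exact Gate.hasSignConstants_mapOps (fun u hu => Operand.hasSignConstants_rwOp _ _ hu)
    (h.1 _ (List.mem_of_mem_take (List.getElem_mem hi)))

/-- **Constant-free normal form**: same value, no larger product-depth, no more wires, well formed,
constant-free, and at most as many gates as wires. [cite: Burgisser2000, Def. 2.1] -/
theorem exists_normalForm_signConst (C : ArithCircuit k σ) (hC : C.HasSignConstants) :
    ∃ N : ArithCircuit k σ, N.WellFormed ∧ N.HasSignConstants ∧ N.eval = C.eval ∧
      N.productDepth ≤ C.productDepth ∧ N.edgeSize ≤ C.edgeSize ∧ N.size ≤ N.edgeSize := by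
  refine ⟨C.pruneEmpty.trimJunk, wellFormed_trimJunk _, (hasSignConstants_pruneEmpty hC).trimJunk,
    ?_, ?_, ?_, ?_⟩
  · rw [eval_trimJunk, eval_pruneEmpty]
  · rw [Bookkeeping.productDepth_trimJunk]; exact productDepth_pruneEmpty_le C
  · rw [edgeSize_trimJunk]; exact edgeSize_pruneEmpty_le C
  · rw [size_trimJunk, edgeSize_trimJunk]; exact size_pruneEmpty_le_edgeSize C

end NormalForm

/-! ### 4. The description dial: budget as a parameter -/

section Dial

/-- PER is EASY for `β`-SUCCINCT constant-free circuits of product-depth `Δ`: for some `c` and every `n`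
there is a constant-free integer circuit whose complexification computes `PER_n` within product-depth
`Δ n` and `n^c + c` wires, and whose code word is computed from a `w`-bit address (`|code| ≤ 2^w`) by a
`B₂`-circuit with at most `β n c` gates.  At `β n c = n + c` its negation is the route's crux
`SuccinctPerHardLog3` (with `Δ = Δ₁`); the budget-as-parameter form of Jansen–Santhanam's succinct
circuits (2011, §1) and of Chen–Kabanets' `α`-succinctness (2012, Def. 2.1). [cite: JansenSanthanam2011, §1] -/
def PerEasySuccinctCF (β : ℕ → ℕ → ℕ) (Δ : ℕ → ℕ) : Prop :=
  ∃ c : ℕ, ∀ n : ℕ, ∃ C : ArithCircuit ℤ (Fin (n * n)), ∃ C' : ArithCircuit ℂ (Fin n × Fin n),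
    C' = (C.map (Int.castRingHom ℂ)).rename ⇑(finProdFinEquiv (m := n) (n := n)).symm ∧
    C.HasSignConstants ∧ C'.Computes (perPoly (Fin n) ℂ) ∧ C'.productDepth ≤ Δ n ∧
    C'.edgeSize ≤ n ^ c + c ∧
    ∃ w : ℕ, (encodeArithCircuit (n * n) C).length ≤ 2 ^ w ∧
      ∃ D : Literature.Computability.Complexity.Circuit (Fin w),
        D.IsOver Literature.Computability.Complexity.B2 ∧ D.size ≤ β n c ∧
          D.Computes fun a =>
            (encodeArithCircuit (n * n) C).getD (∑ t : Fin w, if a t then 2 ^ (t : ℕ) else 0) false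

/- `PerEasyCF Δ` (the constant-free notch without succinctness constraint; its negation at `Δ₁` is the
route's `PerHardLog3CF`) is `SuccinctLiftIntegerAdvice.lean`'s, verbatim the body used by the route. -/

/-- Forgetting the description circuit. [folklore] -/
theorem perEasyCF_of_succinct {β : ℕ → ℕ → ℕ} {Δ : ℕ → ℕ} (h : PerEasySuccinctCF β Δ) :
    PerEasyCF Δ := by
  obtain ⟨c, hc⟩ := h
  refine ⟨c, fun n => ?_⟩
  obtain ⟨C, C', h1, h2, h3, h4, h5, -⟩ := hc n
  exact ⟨C, C', h1, h2, h3, h4, h5⟩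

/- Monotonicity of the wire budget `n ^ c + c` in `c` is the tree's
`OrbitRestorationQPDepthThreeRung.vsbr_pbound_mono` (re-used by name). -/

/-- **Monotonicity of the dial**: a larger description budget (up to re-indexing the constant `c`)
makes PER only easier. [folklore] -/
theorem perEasySuccinctCF_mono {β β' : ℕ → ℕ → ℕ} {Δ : ℕ → ℕ}
    (hβ : ∀ c : ℕ, ∃ c' : ℕ, c ≤ c' ∧ ∀ n : ℕ, β n c ≤ β' n c') (h : PerEasySuccinctCF β Δ) :
    PerEasySuccinctCF β' Δ := by
  obtain ⟨c, hc⟩ := h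
  obtain ⟨c', hcc', hb⟩ := hβ c
  refine ⟨c', fun n => ?_⟩
  obtain ⟨C, C', h1, h2, h3, h4, h5, w, hw, D, hD1, hD2, hD3⟩ := hc n
  exact ⟨C, C', h1, h2, h3, h4,
    h5.trans (OrbitRestorationQPDepthThreeRung.vsbr_pbound_mono hcc' n), w, hw, D, hD1,
    hD2.trans (hb n), hD3⟩

end Dial

end Summit.ValiantsHypothesis.ValiantsHypothesis.Theorems.SuccinctLift
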